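import Mathlib.LinearAlgebra.Matrix.ToLinearEquiv
import Summits.Ventures.HSemireg.WedgeHankelRecurrenceGaussSturmOscillation

/-!
# Venture HSemireg — **THE ZEROS ARE MONOTONE IN THE DIAGONAL RECURRENCE COEFFICIENTS (WEYL ∕ HELLMANN–FEYNMAN FOR JACOBI MATRICES)**: for two positive recurrences with the same `b` and
# `a_i ≤ a'_i` (`i ≤ t`), the zeros of `q_{t+1}` and `q'_{t+1}` satisfy `x_k ≤ x'_k` for every `k`, strictly if `a_i < a'_i` for all `i ≤ t` — proved by the Favard pairing, the
# tridiagonal form `⟨x q_i, q_j⟩` of multiplication by `x`, and an explicit test vector from a singular `(t+1) × (t+1)` system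

HONEST FRAMING. Part of the Lean index of the computation cell `pub-hsemireg` (seat p10 gen 44, Sunday typer «UNIFORM-IN-n»).  Real polynomials, finite sums and one determinant only; no variety,
no cohomology theory, no sheaf, no Ext group and no semiregularity map is constructed here; nothing here says that HC / HC_CM / HC_AV holds; no Literature fact (unproved `Prop`) is declared or
used.  Custodian versions as in `WedgeHankelSiegelIdeal` (1/3).
SOURCES (cited).  H. Weyl, *Das asymptotische Verteilungsgesetz der Eigenwerte linearer partieller Differentialgleichungen*, Math. Ann. 71 (1912) 441–479 (monotonicity of eigenvalues under a
positive semidefinite perturbation); R. Courant, E. Fischer (min–max); M. E. H. Ismail, *Classical and Quantum Orthogonal Polynomials* (2005) §7.3 (zeros as monotone functions of the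
recurrence coefficients via the Hellmann–Feynman theorem, Thm 7.3.1 ∕ 7.3.2); R. A. Horn, C. R. Johnson, *Matrix Analysis* (2nd ed.) Cor. 4.3.12.
PROOF TYPED HERE (no calculus, no min–max over subspaces).  With the Favard weights `μ` at the zeros `x` of `q_{t+1}` (N280: `Σ_k μ_k q_i q_j = δ_{ij} h_i`, `h_i = b_1⋯b_i`):
`Σ_k μ_k x_k q_i(x_k) q_j(x_k) = h_{i+1}[j = i+1] + a_i h_i [i = j] + h_i [i = j+1]`, so for `P = Σ v_i q_i`, `P' = Σ v_i q'_i` (same coefficients) `Σ μ P² = Σ h_i v_i² = Σ μ' P'²` and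
`Σ μ' x' P'² − Σ μ x P² = Σ (a'_i − a_i) h_i v_i² ≥ 0`; a non-zero `v` with `P(x_j) = 0` (`j < k`) and `P'(x'_j) = 0` (`j > k`) exists (`t` linear conditions: a square matrix with a zero row
is singular), and then `x_k Σ h v² ≤ Σ μ x P² ≤ Σ μ' x' P'² ≤ x'_k Σ h v²`.
DEDUP DISCLOSURE (`rg -n 'diagonal_mono|hellmann|weyl_mono|zeros_mono' Summits/Ventures/HSemireg Literature`, 2026-09-03): nothing comparable in the tree (N301 has the Rayleigh extrema of ONE
measure; N298 the trace `Σ x_k = Σ a_i`).  The 8 names below: 0 hits tree-wide.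

WHAT IS IN THE TREE.  N280 `favard_finite`; N279 `recurrence_monic_natDegree`, `eq_prod_X_sub_C_of_monic_of_roots`; N294 `strictMono_eq_of_prod_X_sub_C_eq`; Mathlib
`Matrix.exists_mulVec_eq_zero_iff`, `Matrix.det_eq_zero_of_row_eq_zero`.
THIS FILE (namespace `Summit.Ventures.HSemireg.Wedge.HankelOuter` continued; CHAINED on N322 (import only), N279, N280, N294; 0 definitions):
* §1088 `favard_pairing_at_zeros` (the Favard weights at PRESCRIBED zeros `x`), `weighted_sq_combination_expand` (`Σ_k μ_k ρ_k (Σ_i v_i e_{ik})² = Σ_i Σ_j v_i v_j Σ_k μ_k ρ_k e_{ik} e_{jk}`),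
  `favard_norm_sq_combination` (`Σ μ (Σ v_i q_i)² = Σ h_i v_i²`), **`favard_x_pairing`** (the tridiagonal form of `⟨x q_i, q_j⟩`), `favard_x_form_sub` (`F'(v) − F(v) = Σ (a'_i − a_i) h_i v_i²`),
  `exists_jacobi_test_vector` (non-zero `v` with the `t` vanishing conditions), **`zeros_mono_diagonal`** (`a ≤ a'` ⇒ `x_k ≤ x'_k`), **`zeros_strictMono_diagonal`** (`a < a'` ⇒ `x_k < x'_k`).
CAVEATS.  Positive recurrences sharing `b`; the comparison is coefficient-wise for `i ≤ t`.  Nothing Ext-side.  New names only.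
-/

open Module Polynomial
open scoped Matrix Polynomial

namespace Summit.Ventures.HSemireg.Wedge.HankelOuter

/-! ## §1088. Monotonicity of the zeros in the diagonal recurrence coefficients -/

/-- **The Favard pairing at prescribed zeros**: if `q_{t+1} = ∏ (X − x_j)` with `x` increasing, there are weights `μ_k > 0` with `Σ_k μ_k q_i(x_k) q_j(x_k) = δ_{ij} b_1⋯b_j` (`i, j ≤ t`).
[N280 `favard_finite` with the zeros identified; this file, §1088] -/
theorem favard_pairing_at_zeros {q : ℕ → ℝ[X]} {a b : ℕ → ℝ} (hq0 : q 0 = 1) (hq1 : q 1 = Polynomial.X - C (a 0))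
    (hrec : ∀ n, q (n + 2) = (Polynomial.X - C (a (n + 1))) * q (n + 1) - C (b (n + 1)) * q n) (hb : ∀ j, 0 < b j)
    {t : ℕ} {x : Fin (t + 1) → ℝ} (hx : StrictMono x) (hxq : q (t + 1) = ∏ j, (Polynomial.X - C (x j))) :
    ∃ μ : Fin (t + 1) → ℝ, (∀ k, 0 < μ k) ∧ ∀ i j : Fin (t + 1), ∑ k, μ k * ((q i).eval (x k) * (q j).eval (x k)) = if i = j then ∏ l ∈ Finset.Ico 1 ((j : ℕ) + 1), b l else 0 := by
  obtain ⟨z, μ, hz, hzr, hμ, -, hpair⟩ := favard_finite hq0 hq1 hrec hb t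
  obtain ⟨hm, hd⟩ := recurrence_monic_natDegree hq0 hq1 hrec (t + 1)
  have hzq : q (t + 1) = ∏ k, (Polynomial.X - C (z k)) := eq_prod_X_sub_C_of_monic_of_roots hm hd hz.injective hzr
  have hzx : z = x := strictMono_eq_of_prod_X_sub_C_eq hz hx (hzq.symm.trans hxq)
  subst hzx
  exact ⟨μ, hμ, hpair⟩

/-- `Σ_k μ_k ρ_k (Σ_i v_i e_{ik})² = Σ_i Σ_j v_i v_j Σ_k μ_k ρ_k e_{ik} e_{jk}`. [bookkeeping; this file, §1088] -/
theorem weighted_sq_combination_expand {K I : Type*} [Fintype K] [Fintype I] (μ ρ : K → ℝ) (e : I → K → ℝ) (v : I → ℝ) :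
    ∑ k, μ k * (ρ k * (∑ i, v i * e i k) ^ 2) = ∑ i, ∑ j, v i * v j * ∑ k, μ k * (ρ k * (e i k * e j k)) := by
  have h : ∀ k, μ k * (ρ k * (∑ i, v i * e i k) ^ 2) = ∑ i, ∑ j, v i * v j * (μ k * (ρ k * (e i k * e j k))) := fun k => by
    rw [sq, Finset.sum_mul_sum, Finset.mul_sum, Finset.mul_sum]
    refine Finset.sum_congr rfl fun i _ => ?_
    rw [Finset.mul_sum, Finset.mul_sum]
    exact Finset.sum_congr rfl fun j _ => by ring
  simp_rw [h]
  rw [Finset.sum_comm]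
  refine Finset.sum_congr rfl fun i _ => ?_
  rw [Finset.sum_comm]
  exact Finset.sum_congr rfl fun j _ => by rw [Finset.mul_sum]

/-- **`Σ_k μ_k (Σ_i v_i q_i(x_k))² = Σ_i h_i v_i²`** for a pairing with `Σ_k μ_k q_i q_j = δ_{ij} h_j`. [this file, §1088] -/
theorem favard_norm_sq_combination {t : ℕ} {μ x : Fin (t + 1) → ℝ} {q : ℕ → ℝ[X]} {h : ℕ → ℝ}
    (hpair : ∀ i j : Fin (t + 1), ∑ k, μ k * ((q i).eval (x k) * (q j).eval (x k)) = if i = j then h j else 0) (v : Fin (t + 1) → ℝ) :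
    ∑ k, μ k * ((∑ i : Fin (t + 1), C (v i) * q i).eval (x k)) ^ 2 = ∑ i : Fin (t + 1), h i * v i ^ 2 := by
  have hev : ∀ y, (∑ i : Fin (t + 1), C (v i) * q i).eval y = ∑ i : Fin (t + 1), v i * (q i).eval y := fun y => by
    rw [eval_finsetSum]; exact Finset.sum_congr rfl fun i _ => by rw [eval_mul, eval_C]
  simp_rw [hev]
  have h1 := weighted_sq_combination_expand μ (fun _ => (1 : ℝ)) (fun (i : Fin (t + 1)) k => (q i).eval (x k)) v
  simp only [one_mul] at h1
  rw [h1]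
  refine Finset.sum_congr rfl fun i _ => ?_
  simp only [hpair, mul_ite, mul_zero, Finset.sum_ite_eq, Finset.mem_univ, if_true]
  ring

/-- **THE TRIDIAGONAL FORM OF MULTIPLICATION BY `x`: `Σ_k μ_k x_k q_i(x_k) q_j(x_k) = h_{i+1}[j = i+1] + a_i h_i[i = j] + h_i[i = j+1]`** (`i, j ≤ t`; `h_n = b_1⋯b_n`; the zeros `x` of `q_{t+1}` kill
the term `q_{t+1}`). [Ismail (2.2.1) ∕ §7.3; this file, §1088] -/
theorem favard_x_pairing {q : ℕ → ℝ[X]} {a b : ℕ → ℝ} (hq0 : q 0 = 1) (hq1 : q 1 = Polynomial.X - C (a 0))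
    (hrec : ∀ n, q (n + 2) = (Polynomial.X - C (a (n + 1))) * q (n + 1) - C (b (n + 1)) * q n)
    {t : ℕ} {μ x : Fin (t + 1) → ℝ} (hxr : ∀ k, (q (t + 1)).eval (x k) = 0)
    (hpair : ∀ i j : Fin (t + 1), ∑ k, μ k * ((q i).eval (x k) * (q j).eval (x k)) = if i = j then ∏ l ∈ Finset.Ico 1 ((j : ℕ) + 1), b l else 0)
    (i j : Fin (t + 1)) :
    ∑ k, μ k * (x k * ((q i).eval (x k) * (q j).eval (x k))) =
      (if (i : ℕ) + 1 = j then ∏ l ∈ Finset.Ico 1 ((j : ℕ) + 1), b l else 0) + (if (i : ℕ) = j then a i * ∏ l ∈ Finset.Ico 1 ((j : ℕ) + 1), b l else 0) +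
        (if (i : ℕ) = j + 1 then ∏ l ∈ Finset.Ico 1 ((i : ℕ) + 1), b l else 0) := by
  -- pairing with an index `n ≤ t + 1` in the first slot (as a natural number)
  have hpairN : ∀ n, n ≤ t + 1 → ∀ j : Fin (t + 1), ∑ k, μ k * ((q n).eval (x k) * (q j).eval (x k)) =
      if n = j then ∏ l ∈ Finset.Ico 1 ((j : ℕ) + 1), b l else 0 := by
    intro n hn j
    rcases hn.lt_or_eq with hlt | heq
    · have h := hpair ⟨n, hlt⟩ j
      simp only [Fin.ext_iff] at h
      exact h
    · rw [heq, if_neg (by have := j.is_lt; omega)]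
      exact Finset.sum_eq_zero fun k _ => by rw [hxr k, zero_mul, mul_zero]
  -- `x q_i = q_{i+1} + a_i q_i + b_i q_{i-1}` at the nodes
  obtain ⟨i, hi⟩ := i
  rcases i with _ | i
  · -- `i = 0`: `x q_0 = q_1 + a_0 q_0`
    have hxq : ∀ k, x k * (q 0).eval (x k) = (q 1).eval (x k) + a 0 * (q 0).eval (x k) := fun k => by
      rw [hq1, hq0, eval_sub, eval_X, eval_C, eval_one]; ring
    have hl : ∀ k, μ k * (x k * ((q 0).eval (x k) * (q j).eval (x k))) = μ k * ((q 1).eval (x k) * (q j).eval (x k)) + a 0 * (μ k * ((q 0).eval (x k) * (q j).eval (x k))) := fun k => by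
      rw [← mul_assoc (x k), hxq k]; ring
    rw [Finset.sum_congr rfl fun k _ => hl k, Finset.sum_add_distrib, ← Finset.mul_sum, hpairN 1 (by omega) j, hpairN 0 (by omega) j, Nat.zero_add]
    by_cases hj1 : (j : ℕ) = 1
    · rw [hj1]; simp
    · by_cases hj0 : (j : ℕ) = 0
      · rw [hj0]; simp
      · have h1 : ¬ (1 = (j : ℕ)) := fun h => hj1 h.symm
        have h0 : ¬ (0 = (j : ℕ)) := fun h => hj0 h.symm
        have h0' : ¬ (0 = (j : ℕ) + 1) := by omega
        simp [h1, h0]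
  · -- `i + 1 ≥ 1`: `x q_{i+1} = q_{i+2} + a_{i+1} q_{i+1} + b_{i+1} q_i`
    have hxq : ∀ k, x k * (q (i + 1)).eval (x k) = (q (i + 2)).eval (x k) + a (i + 1) * (q (i + 1)).eval (x k) + b (i + 1) * (q i).eval (x k) := fun k => by
      rw [hrec i, eval_sub, eval_mul, eval_sub, eval_X, eval_C, eval_mul, eval_C]; ring
    have hl : ∀ k, μ k * (x k * ((q (i + 1)).eval (x k) * (q j).eval (x k))) = μ k * ((q (i + 2)).eval (x k) * (q j).eval (x k)) +
        a (i + 1) * (μ k * ((q (i + 1)).eval (x k) * (q j).eval (x k))) + b (i + 1) * (μ k * ((q i).eval (x k) * (q j).eval (x k))) := fun k => by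
      rw [← mul_assoc (x k), hxq k]; ring
    rw [Finset.sum_congr rfl fun k _ => hl k, Finset.sum_add_distrib, Finset.sum_add_distrib, ← Finset.mul_sum, ← Finset.mul_sum, hpairN (i + 2) (by omega) j,
      hpairN (i + 1) (by omega) j, hpairN i (by omega) j]
    have hprod : b (i + 1) * ∏ l ∈ Finset.Ico 1 (i + 1), b l = ∏ l ∈ Finset.Ico 1 (i + 1 + 1), b l := by
      rw [Finset.prod_Ico_succ_top (show 1 ≤ i + 1 by omega) b, mul_comm]
    by_cases hj2 : (j : ℕ) = i + 2
    · have e1 : ¬ (i + 1 = (j : ℕ)) := by omega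
      have e2 : ¬ (i = (j : ℕ)) := by omega
      have e4 : ¬ (i + 1 = (j : ℕ) + 1) := by omega
      have e5 : i + 2 = (j : ℕ) := by omega
      simp only [if_pos e5, if_neg e1, if_neg e2, if_neg e4, mul_zero, add_zero]
    · by_cases hj1 : (j : ℕ) = i + 1
      · have e1 : ¬ (i + 2 = (j : ℕ)) := by omega
        have e2 : i + 1 = (j : ℕ) := by omega
        have e3 : ¬ (i = (j : ℕ)) := by omega
        have e5 : ¬ (i + 1 = (j : ℕ) + 1) := by omega
        simp only [if_neg e1, if_pos e2, if_neg e3, if_neg e5, mul_zero, add_zero, zero_add]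
      · by_cases hj0 : (j : ℕ) = i
        · have e1 : ¬ (i + 2 = (j : ℕ)) := by omega
          have e2 : ¬ (i + 1 = (j : ℕ)) := by omega
          have e3 : i = (j : ℕ) := by omega
          have e5 : i + 1 = (j : ℕ) + 1 := by omega
          simp only [if_neg e1, if_neg e2, if_pos e3, if_pos e5, mul_zero, add_zero, zero_add]
          rw [← hprod, ← e3]
        · have e1 : ¬ (i + 2 = (j : ℕ)) := by omega
          have e2 : ¬ (i + 1 = (j : ℕ)) := by omega
          have e3 : ¬ (i = (j : ℕ)) := by omega
          have e5 : ¬ (i + 1 = (j : ℕ) + 1) := by omega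
          simp only [if_neg e1, if_neg e2, if_neg e3, if_neg e5, mul_zero, add_zero]

/-- **The difference of the two `x`-forms is diagonal: `Σ μ' x' P'² − Σ μ x P² = Σ_i (a'_i − a_i) h_i v_i²`** for `P = Σ v_i q_i`, `P' = Σ v_i q'_i` (same coefficients, same `b`).
[Ismail §7.3 (Hellmann–Feynman); this file, §1088] -/
theorem favard_x_form_sub {q q' : ℕ → ℝ[X]} {a a' b : ℕ → ℝ} (hq0 : q 0 = 1) (hq1 : q 1 = Polynomial.X - C (a 0))
    (hrec : ∀ n, q (n + 2) = (Polynomial.X - C (a (n + 1))) * q (n + 1) - C (b (n + 1)) * q n)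
    (hq0' : q' 0 = 1) (hq1' : q' 1 = Polynomial.X - C (a' 0)) (hrec' : ∀ n, q' (n + 2) = (Polynomial.X - C (a' (n + 1))) * q' (n + 1) - C (b (n + 1)) * q' n)
    {t : ℕ} {μ x μ' y : Fin (t + 1) → ℝ} (hxr : ∀ k, (q (t + 1)).eval (x k) = 0) (hyr : ∀ k, (q' (t + 1)).eval (y k) = 0)
    (hpair : ∀ i j : Fin (t + 1), ∑ k, μ k * ((q i).eval (x k) * (q j).eval (x k)) = if i = j then ∏ l ∈ Finset.Ico 1 ((j : ℕ) + 1), b l else 0)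
    (hpair' : ∀ i j : Fin (t + 1), ∑ k, μ' k * ((q' i).eval (y k) * (q' j).eval (y k)) = if i = j then ∏ l ∈ Finset.Ico 1 ((j : ℕ) + 1), b l else 0)
    (v : Fin (t + 1) → ℝ) :
    ∑ k, μ' k * (y k * ((∑ i : Fin (t + 1), C (v i) * q' i).eval (y k)) ^ 2) - ∑ k, μ k * (x k * ((∑ i : Fin (t + 1), C (v i) * q i).eval (x k)) ^ 2) =
      ∑ i : Fin (t + 1), (a' i - a i) * (∏ l ∈ Finset.Ico 1 ((i : ℕ) + 1), b l) * v i ^ 2 := by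
  have hev : ∀ (r : ℕ → ℝ[X]) (z : ℝ), (∑ i : Fin (t + 1), C (v i) * r i).eval z = ∑ i : Fin (t + 1), v i * (r i).eval z := fun r z => by
    rw [eval_finsetSum]; exact Finset.sum_congr rfl fun i _ => by rw [eval_mul, eval_C]
  simp_rw [hev]
  rw [weighted_sq_combination_expand μ' y (fun (i : Fin (t + 1)) k => (q' i).eval (y k)) v, weighted_sq_combination_expand μ x (fun (i : Fin (t + 1)) k => (q i).eval (x k)) v,
    ← Finset.sum_sub_distrib]
  refine Finset.sum_congr rfl fun i _ => ?_
  rw [← Finset.sum_sub_distrib]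
  have hl : ∀ j : Fin (t + 1), v i * v j * ∑ k, μ' k * (y k * ((q' i).eval (y k) * (q' j).eval (y k))) - v i * v j * ∑ k, μ k * (x k * ((q i).eval (x k) * (q j).eval (x k))) =
      if i = j then (a' i - a i) * (∏ l ∈ Finset.Ico 1 ((i : ℕ) + 1), b l) * v i ^ 2 else 0 := fun j => by
    rw [favard_x_pairing hq0' hq1' hrec' hyr hpair' i j, favard_x_pairing hq0 hq1 hrec hxr hpair i j]
    have key : ∀ T₁ T₃ A A' : ℝ, v i * v j * (T₁ + A' + T₃) - v i * v j * (T₁ + A + T₃) = v i * v j * (A' - A) := fun _ _ _ _ => by ring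
    rw [key]
    by_cases hij : i = j
    · subst hij
      simp only [if_true]
      ring
    · have hij' : ¬ ((i : ℕ) = j) := fun h => hij (Fin.ext h)
      simp only [if_neg hij, if_neg hij', sub_self, mul_zero]
  rw [Finset.sum_congr rfl fun j _ => hl j, Finset.sum_ite_eq]
  simp only [Finset.mem_univ, if_true]

/-- **A test vector**: for `k : Fin (t+1)` there is `v ≠ 0` with `Σ_i v_i q_i(x_j) = 0` for `j < k` and `Σ_i v_i q'_i(y_j) = 0` for `j > k` (`t` homogeneous linear conditions on `t + 1` unknowns —
the square system with a zero `k`-th row is singular). [this file, §1088] -/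
theorem exists_jacobi_test_vector {t : ℕ} (e e' : Fin (t + 1) → Fin (t + 1) → ℝ) (k : Fin (t + 1)) :
    ∃ v : Fin (t + 1) → ℝ, v ≠ 0 ∧ (∀ j, j < k → ∑ i, v i * e i j = 0) ∧ ∀ j, k < j → ∑ i, v i * e' i j = 0 := by
  classical
  set A : Matrix (Fin (t + 1)) (Fin (t + 1)) ℝ := Matrix.of fun j i => if j < k then e i j else if k < j then e' i j else 0 with hA
  have hdet : A.det = 0 := Matrix.det_eq_zero_of_row_eq_zero k fun i => by simp [hA]
  obtain ⟨v, hv0, hAv⟩ := Matrix.exists_mulVec_eq_zero_iff.2 hdet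
  refine ⟨v, hv0, fun j hj => ?_, fun j hj => ?_⟩
  · have h := congr_fun hAv j
    rw [Matrix.mulVec, Pi.zero_apply] at h
    change ∑ i, A j i * v i = 0 at h
    simp only [hA, Matrix.of_apply, if_pos hj] at h
    rw [← h]; exact Finset.sum_congr rfl fun i _ => mul_comm _ _
  · have h := congr_fun hAv j
    rw [Matrix.mulVec, Pi.zero_apply] at h
    change ∑ i, A j i * v i = 0 at h
    simp only [hA, Matrix.of_apply, if_neg (not_lt.2 hj.le), if_pos hj] at h
    rw [← h]; exact Finset.sum_congr rfl fun i _ => mul_comm _ _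

/-- **THE ZEROS ARE NON-DECREASING IN THE DIAGONAL COEFFICIENTS: same `b > 0`, `a_i ≤ a'_i` for `i ≤ t` ⇒ `x_k ≤ x'_k` for every zero of `q_{t+1}` ∕ `q'_{t+1}`.**
[Weyl 1912; Ismail Thm 7.3.1; Horn–Johnson Cor. 4.3.12; this file, §1088] -/
theorem zeros_mono_diagonal {q q' : ℕ → ℝ[X]} {a a' b : ℕ → ℝ} (hq0 : q 0 = 1) (hq1 : q 1 = Polynomial.X - C (a 0))
    (hrec : ∀ n, q (n + 2) = (Polynomial.X - C (a (n + 1))) * q (n + 1) - C (b (n + 1)) * q n)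
    (hq0' : q' 0 = 1) (hq1' : q' 1 = Polynomial.X - C (a' 0)) (hrec' : ∀ n, q' (n + 2) = (Polynomial.X - C (a' (n + 1))) * q' (n + 1) - C (b (n + 1)) * q' n)
    (hb : ∀ j, 0 < b j) {t : ℕ} (haa' : ∀ i, i ≤ t → a i ≤ a' i)
    {x y : Fin (t + 1) → ℝ} (hx : StrictMono x) (hxq : q (t + 1) = ∏ j, (Polynomial.X - C (x j))) (hy : StrictMono y) (hyq : q' (t + 1) = ∏ j, (Polynomial.X - C (y j)))
    (k : Fin (t + 1)) : x k ≤ y k := by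
  obtain ⟨μ, hμ, hpair⟩ := favard_pairing_at_zeros hq0 hq1 hrec hb hx hxq
  obtain ⟨μ', hμ', hpair'⟩ := favard_pairing_at_zeros hq0' hq1' hrec' hb hy hyq
  have hxr : ∀ j, (q (t + 1)).eval (x j) = 0 := fun j => by
    rw [hxq, eval_prod]; exact Finset.prod_eq_zero (Finset.mem_univ j) (by rw [eval_sub, eval_X, eval_C, sub_self])
  have hyr : ∀ j, (q' (t + 1)).eval (y j) = 0 := fun j => by
    rw [hyq, eval_prod]; exact Finset.prod_eq_zero (Finset.mem_univ j) (by rw [eval_sub, eval_X, eval_C, sub_self])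
  obtain ⟨v, hv0, hvx, hvy⟩ := exists_jacobi_test_vector (fun i j => (q i).eval (x j)) (fun i j => (q' i).eval (y j)) k
  set P : ℝ[X] := ∑ i : Fin (t + 1), C (v i) * q i with hP
  set P' : ℝ[X] := ∑ i : Fin (t + 1), C (v i) * q' i with hP'
  have hev : ∀ (r : ℕ → ℝ[X]) (z : ℝ), (∑ i : Fin (t + 1), C (v i) * r i).eval z = ∑ i : Fin (t + 1), v i * (r i).eval z := fun r z => by
    rw [eval_finsetSum]; exact Finset.sum_congr rfl fun i _ => by rw [eval_mul, eval_C]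
  have hPx : ∀ j, j < k → P.eval (x j) = 0 := fun j hj => by rw [hP, hev]; exact hvx j hj
  have hPy : ∀ j, k < j → P'.eval (y j) = 0 := fun j hj => by rw [hP', hev]; exact hvy j hj
  -- the common norm `G = Σ h_i v_i² > 0`
  have hG : ∑ j, μ j * (P.eval (x j)) ^ 2 = ∑ i : Fin (t + 1), (∏ l ∈ Finset.Ico 1 ((i : ℕ) + 1), b l) * v i ^ 2 := favard_norm_sq_combination (h := fun n => ∏ l ∈ Finset.Ico 1 (n + 1), b l) hpair v
  have hG' : ∑ j, μ' j * (P'.eval (y j)) ^ 2 = ∑ i : Fin (t + 1), (∏ l ∈ Finset.Ico 1 ((i : ℕ) + 1), b l) * v i ^ 2 := favard_norm_sq_combination (h := fun n => ∏ l ∈ Finset.Ico 1 (n + 1), b l) hpair' v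
  have hGpos : 0 < ∑ i : Fin (t + 1), (∏ l ∈ Finset.Ico 1 ((i : ℕ) + 1), b l) * v i ^ 2 := by
    obtain ⟨i₀, hi₀⟩ := Function.ne_iff.1 hv0
    exact Finset.sum_pos' (fun i _ => mul_nonneg (Finset.prod_nonneg fun l _ => (hb l).le) (sq_nonneg _))
      ⟨i₀, Finset.mem_univ _, mul_pos (Finset.prod_pos fun l _ => hb l) (sq_pos_iff.2 hi₀)⟩
  -- one-sided bounds on the rules themselves
  have h1 : x k * ∑ j, μ j * (P.eval (x j)) ^ 2 ≤ ∑ j, μ j * (x j * (P.eval (x j)) ^ 2) := by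
    rw [Finset.mul_sum, ← sub_nonneg, ← Finset.sum_sub_distrib]
    refine Finset.sum_nonneg fun j _ => ?_
    rw [show μ j * (x j * (P.eval (x j)) ^ 2) - x k * (μ j * (P.eval (x j)) ^ 2) = μ j * ((x j - x k) * (P.eval (x j)) ^ 2) by ring]
    rcases lt_or_ge j k with hjk | hjk
    · rw [hPx j hjk, sq, mul_zero, mul_zero, mul_zero]
    · exact mul_nonneg (hμ j).le (mul_nonneg (sub_nonneg.2 (hx.monotone hjk)) (sq_nonneg _))
  have h2 : ∑ j, μ' j * (y j * (P'.eval (y j)) ^ 2) ≤ y k * ∑ j, μ' j * (P'.eval (y j)) ^ 2 := by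
    rw [Finset.mul_sum, ← sub_nonneg, ← Finset.sum_sub_distrib]
    refine Finset.sum_nonneg fun j _ => ?_
    rw [show y k * (μ' j * (P'.eval (y j)) ^ 2) - μ' j * (y j * (P'.eval (y j)) ^ 2) = μ' j * ((y k - y j) * (P'.eval (y j)) ^ 2) by ring]
    rcases lt_or_ge k j with hjk | hjk
    · rw [hPy j hjk, sq, mul_zero, mul_zero, mul_zero]
    · exact mul_nonneg (hμ' j).le (mul_nonneg (sub_nonneg.2 (hy.monotone hjk)) (sq_nonneg _))
  -- the Hellmann–Feynman difference
  have h3 : ∑ j, μ j * (x j * (P.eval (x j)) ^ 2) ≤ ∑ j, μ' j * (y j * (P'.eval (y j)) ^ 2) := by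
    rw [← sub_nonneg, hP, hP', favard_x_form_sub hq0 hq1 hrec hq0' hq1' hrec' hxr hyr hpair hpair' v]
    exact Finset.sum_nonneg fun i _ => mul_nonneg (mul_nonneg (sub_nonneg.2 (haa' i (Nat.lt_succ_iff.1 i.is_lt))) (Finset.prod_nonneg fun l _ => (hb l).le)) (sq_nonneg _)
  rw [hG] at h1
  rw [hG'] at h2
  exact le_of_mul_le_mul_right ((h1.trans h3).trans h2) hGpos

/-- **Strict form: `a_i < a'_i` for all `i ≤ t` ⇒ `x_k < x'_k`.** [Ismail Thm 7.3.1; this file, §1088] -/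
theorem zeros_strictMono_diagonal {q q' : ℕ → ℝ[X]} {a a' b : ℕ → ℝ} (hq0 : q 0 = 1) (hq1 : q 1 = Polynomial.X - C (a 0))
    (hrec : ∀ n, q (n + 2) = (Polynomial.X - C (a (n + 1))) * q (n + 1) - C (b (n + 1)) * q n)
    (hq0' : q' 0 = 1) (hq1' : q' 1 = Polynomial.X - C (a' 0)) (hrec' : ∀ n, q' (n + 2) = (Polynomial.X - C (a' (n + 1))) * q' (n + 1) - C (b (n + 1)) * q' n)
    (hb : ∀ j, 0 < b j) {t : ℕ} (haa' : ∀ i, i ≤ t → a i < a' i)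
    {x y : Fin (t + 1) → ℝ} (hx : StrictMono x) (hxq : q (t + 1) = ∏ j, (Polynomial.X - C (x j))) (hy : StrictMono y) (hyq : q' (t + 1) = ∏ j, (Polynomial.X - C (y j)))
    (k : Fin (t + 1)) : x k < y k := by
  obtain ⟨μ, hμ, hpair⟩ := favard_pairing_at_zeros hq0 hq1 hrec hb hx hxq
  obtain ⟨μ', hμ', hpair'⟩ := favard_pairing_at_zeros hq0' hq1' hrec' hb hy hyq
  have hxr : ∀ j, (q (t + 1)).eval (x j) = 0 := fun j => by
    rw [hxq, eval_prod]; exact Finset.prod_eq_zero (Finset.mem_univ j) (by rw [eval_sub, eval_X, eval_C, sub_self])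
  have hyr : ∀ j, (q' (t + 1)).eval (y j) = 0 := fun j => by
    rw [hyq, eval_prod]; exact Finset.prod_eq_zero (Finset.mem_univ j) (by rw [eval_sub, eval_X, eval_C, sub_self])
  obtain ⟨v, hv0, hvx, hvy⟩ := exists_jacobi_test_vector (fun i j => (q i).eval (x j)) (fun i j => (q' i).eval (y j)) k
  set P : ℝ[X] := ∑ i : Fin (t + 1), C (v i) * q i with hP
  set P' : ℝ[X] := ∑ i : Fin (t + 1), C (v i) * q' i with hP'
  have hev : ∀ (r : ℕ → ℝ[X]) (z : ℝ), (∑ i : Fin (t + 1), C (v i) * r i).eval z = ∑ i : Fin (t + 1), v i * (r i).eval z := fun r z => by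
    rw [eval_finsetSum]; exact Finset.sum_congr rfl fun i _ => by rw [eval_mul, eval_C]
  have hPx : ∀ j, j < k → P.eval (x j) = 0 := fun j hj => by rw [hP, hev]; exact hvx j hj
  have hPy : ∀ j, k < j → P'.eval (y j) = 0 := fun j hj => by rw [hP', hev]; exact hvy j hj
  have hG : ∑ j, μ j * (P.eval (x j)) ^ 2 = ∑ i : Fin (t + 1), (∏ l ∈ Finset.Ico 1 ((i : ℕ) + 1), b l) * v i ^ 2 := favard_norm_sq_combination (h := fun n => ∏ l ∈ Finset.Ico 1 (n + 1), b l) hpair v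
  have hG' : ∑ j, μ' j * (P'.eval (y j)) ^ 2 = ∑ i : Fin (t + 1), (∏ l ∈ Finset.Ico 1 ((i : ℕ) + 1), b l) * v i ^ 2 := favard_norm_sq_combination (h := fun n => ∏ l ∈ Finset.Ico 1 (n + 1), b l) hpair' v
  obtain ⟨i₀, hi₀⟩ := Function.ne_iff.1 hv0
  have hGpos : 0 < ∑ i : Fin (t + 1), (∏ l ∈ Finset.Ico 1 ((i : ℕ) + 1), b l) * v i ^ 2 :=
    Finset.sum_pos' (fun i _ => mul_nonneg (Finset.prod_nonneg fun l _ => (hb l).le) (sq_nonneg _))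
      ⟨i₀, Finset.mem_univ _, mul_pos (Finset.prod_pos fun l _ => hb l) (sq_pos_iff.2 hi₀)⟩
  have h1 : x k * ∑ j, μ j * (P.eval (x j)) ^ 2 ≤ ∑ j, μ j * (x j * (P.eval (x j)) ^ 2) := by
    rw [Finset.mul_sum, ← sub_nonneg, ← Finset.sum_sub_distrib]
    refine Finset.sum_nonneg fun j _ => ?_
    rw [show μ j * (x j * (P.eval (x j)) ^ 2) - x k * (μ j * (P.eval (x j)) ^ 2) = μ j * ((x j - x k) * (P.eval (x j)) ^ 2) by ring]
    rcases lt_or_ge j k with hjk | hjk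
    · rw [hPx j hjk, sq, mul_zero, mul_zero, mul_zero]
    · exact mul_nonneg (hμ j).le (mul_nonneg (sub_nonneg.2 (hx.monotone hjk)) (sq_nonneg _))
  have h2 : ∑ j, μ' j * (y j * (P'.eval (y j)) ^ 2) ≤ y k * ∑ j, μ' j * (P'.eval (y j)) ^ 2 := by
    rw [Finset.mul_sum, ← sub_nonneg, ← Finset.sum_sub_distrib]
    refine Finset.sum_nonneg fun j _ => ?_
    rw [show y k * (μ' j * (P'.eval (y j)) ^ 2) - μ' j * (y j * (P'.eval (y j)) ^ 2) = μ' j * ((y k - y j) * (P'.eval (y j)) ^ 2) by ring]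
    rcases lt_or_ge k j with hjk | hjk
    · rw [hPy j hjk, sq, mul_zero, mul_zero, mul_zero]
    · exact mul_nonneg (hμ' j).le (mul_nonneg (sub_nonneg.2 (hy.monotone hjk)) (sq_nonneg _))
  have h3 : ∑ j, μ j * (x j * (P.eval (x j)) ^ 2) < ∑ j, μ' j * (y j * (P'.eval (y j)) ^ 2) := by
    rw [← sub_pos, hP, hP', favard_x_form_sub hq0 hq1 hrec hq0' hq1' hrec' hxr hyr hpair hpair' v]
    exact Finset.sum_pos' (fun i _ => mul_nonneg (mul_nonneg (sub_nonneg.2 (haa' i (Nat.lt_succ_iff.1 i.is_lt)).le) (Finset.prod_nonneg fun l _ => (hb l).le)) (sq_nonneg _))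
      ⟨i₀, Finset.mem_univ _, mul_pos (mul_pos (sub_pos.2 (haa' i₀ (Nat.lt_succ_iff.1 i₀.is_lt))) (Finset.prod_pos fun l _ => hb l)) (sq_pos_iff.2 hi₀)⟩
  rw [hG] at h1
  rw [hG'] at h2
  exact lt_of_mul_lt_mul_right ((h1.trans_lt h3).trans_le h2) hGpos.le

end Summit.Ventures.HSemireg.Wedge.HankelOuter
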